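import Summits.HodgeConjecture.HodgeConjecture.Theorems.Ring2AbelianAllEvenTimesEven
import Literature.AlgebraicGeometry.HodgeTheory.WeilTypeProducts
import Literature.AlgebraicGeometry.HodgeTheory.AbelianVarietyPullbackQuadratic
import HarnessLib

/-!
# Ring 2 · AbelianAll (ab-weil-1, gen 108) — `det H` under the conjugate structure `φ ↦ -φ`, and the
  CONJUGATE-TWISTED products `(A × B, φ × (-ψ))`: class `δ_A · δ_B`; two members of ONE component
  `(n, d, δ)` have a twisted product of SPLIT Weil type `(2n, 2n)`, on the carriers

research route, not a corollary; conditional on HC_CM plus one named minimal statement.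
Cell line: research route conditional on HC_CM; not a corollary; Q11.4-sentence-2 already refuted in dim ≥ 3.

`HC_CM` (`Theses.RankFourFaces.CMAbelianHodge`) does not occur in this file and no case of the Hodge conjecture is
claimed: §§1–3 are (bi)linear algebra on the cohomology carriers and the arithmetic of `K_d = ℚ[X]/(X² + d)`; §4 takes
the cell's split class target `Ring2.Hypotheses.WeilClassesComponent (n + n) d [(-1)^{n+n}]` as a BINDER. No definition,
no named fact, no `sorry`.

CONTEXT (cell bus, ab-andre-2 gen 40, PART XLVIII, `## §AbelianAll (ab-andre-2, gen 40)` AA2.323–AA2.333): for the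
Weil-type pencils the node `B⋆(𝒳) ∀η ⟺ β` was proved equivalent (Verdier for ⟸) to the Weil Hodge conjecture for the
CONJUGATE-TWISTED products `X_s × X̄_t` — `(A_s × A_t, Φ)` with `Φ = prodLift (fst ≫ φ_s) (snd ≫ (-φ_t))`
(`Ring2AbelianAllAndreConjugateWeilLines` §3) — with the print dictionary "`disc(X_s × X̄_t) = δ_s δ̄_t = δ² ∈ N(K^×)`,
the twisted products are of SPLIT type whatever the fibre discriminant [vanGeemen1994HodgeAV Lemma 5.2 (3); Landherr]"
recorded in docstrings as NOT formalised ("no Hermitian form on the carriers", AA2.331). The Hermitian form IS on the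
carriers in this tree — `VanGeemen1994.HasWeilDiscriminantNondeg A φ n d h δ` (`Literature/AlgebraicGeometry/VanGeemen1994/
WeilDiscriminantClass`: a rational `K`-frame `x`, the Gram matrix `Ψ = a + b√-d` of `H(x, y) = E(x, φ^*y) + √-d E(x, y)`,
`det Ψ = q ∈ ℚˣ`, class `δ = [q] ∈ ℚˣ/Nm(K_dˣ)`), with multiplicativity under products (this seat, gen 8,
`hasWeilDiscriminantNondeg_prod`) and Landherr's converse on the carriers
(`VanGeemen1994.IsWeilType.isSplitWeilType_of_hasWeilDiscriminantNondeg_split`, used through ab-weil-2's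
`isSplitWeilType_prod_of_class_eq_of_isWeilType`). This file supplies the one missing link — the behaviour of `det H`
under the conjugate structure `φ ↦ -φ` — and draws the twisted-product statements:

* §1 **`hasWeilDiscriminantNondeg_neg_iff`: `(A, -φ, h)` has non-degenerate class `δ` iff `(A, φ, h)` has** — in one
  rational `K`-frame `x` the Gram matrix of `-φ` is `Ψ' = -a + b√-d = -σ(Ψ)` (`σ` = complex conjugation of `K_d`, the
  tree's `weilFieldHom d d (-1)`), so `det Ψ' = (-1)^{2n} σ(det Ψ) = det Ψ = q` (`det_weilGramMatrix_neg_left`): the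
  conjugate variety `X̄` lies in the SAME component `(n, d, δ)` as `X` ("`δ̄ = δ`": `δ ∈ ℚˣ`).
* §2 **`hasWeilDiscriminantNondeg_twistedProd`**: for `(A, φ, h_A)` of class `δ_A` (`K`-rank `2n_A`) and `(B, ψ, h_B)` of
  class `δ_B` (`K`-rank `2n_B`), rational classes of non-zero top powers, the twisted product
  `(A × B, φ × (-ψ), pr_A^*h_A + pr_B^*h_B)` has a non-degenerate witness of class `δ_A · δ_B` (§1 + gen 8); it is of Weil
  type `(n_A + n_B, d)` when the factors are of Weil types `(n_A, d)`, `(n_B, d)` (`isWeilType_twistedProd`: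
  `HodgeTheory.IsWeilType.neg` and `.prod`).
* §3 **TWO MEMBERS OF ONE COMPONENT.** `splitDiscriminantClass_add_self`: `[(-1)^{n+n}] = 1`; for `(A, φ)`, `(B, ψ)` both of
  `K`-rank `2n` with classes EQUAL to one `δ`, the twisted product has the SPLIT class
  (`hasWeilDiscriminantNondeg_twistedProd_split`: `δ · δ = 1 = [(-1)^{2n}]`, `weilNormResidueGroup_mul_self`), and — for two
  pairs of Weil type `(n, d)` whose `K`-symmetrised hyperplane classes `d·e^*a + φ^*e^*a` lie in one component `(n, d, δ)` —
  **`isSplitWeilType_twistedProd_of_class_eq`: `(A × B, φ × (-ψ))` is of SPLIT Weil type `(n + n, d)`** (the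
  `K`-symmetrisation is blind to the sign of `ψ` in degree two, `HodgeTheory.map_neg_two`; then ab-weil-2's
  `isSplitWeilType_prod_of_class_eq_of_isWeilType` for `(A, φ)` and `(B, -ψ)`). This is the kernel form of the print
  sentence quoted above, for two members `X_s`, `X_t` of one discriminant component — in particular for two members of
  one Weil-type pencil on which `det H` is constant.
* §4 **`weilClasses_algebraic_twistedProd_of_split_component`** — the edge to the cell's ladder: granted the split class
  target `WeilClassesComponent (n + n) d (splitDiscriminantClass (n + n) d)` ALONE, every rational Weil class of Hodge type
  `(n + n, n + n)` of the twisted product of two members of a component `(n, d, δ)` is algebraic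
  (`Ring2.Hypotheses.weilClasses_algebraic_of_isSplitWeilType_of_split_component`). NODE LEVEL: nothing new is claimed —
  "Weil-HC for the split `4n`-folds ⟹ for all `2n`-folds" is the known Schoen/Markman descent; this is the typed,
  member-wise edge «split cell `(2n, d, [1])` ⟹ Weil classes of `X_s × X̄_t`» that the twisted-product rows consume.

NOT PROVED here: constancy of `det H` along a connected family (so "two members of one pencil" enter through the
hypothesis "same class `δ`"), and anything about the Weil PLANE `weilClassesOf` beyond its rational Hodge classes.

## References

* B. van Geemen, *An introduction to the Hodge conjecture for abelian varieties*, LNM 1594 (1994), 4.14,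
  Lemma 5.2 (2)–(4), 5.4 and (5.4.1). [vanGeemen1994HodgeAV]
* W. Landherr, Äquivalenz Hermitescher Formen über einem beliebigen algebraischen Zahlkörper, Abh. Math. Sem.
  Hamburg 11 (1936) 245–248. [Landherr1936HermitianForms]
* Ch. Birkenhake, H. Lange, *Complex Abelian Varieties* (1992/2004), §1.1 (p. 19), Lemma 1.1.17. [LangeBirkenhake1992]
* E. Markman, arXiv:2509.23403, §1.1 and §11.5 (the invariant `(n, K, det H)`, product polarizations; preprint).
  [Markman2025SurveySecant]
-/

noncomputable section

set_option linter.dupNamespace false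

open CategoryTheory Polynomial
open Literature.AlgebraicGeometry Literature.AlgebraicGeometry.Motives
open Literature.AlgebraicGeometry.HodgeTheory
open Literature.AlgebraicGeometry.VanGeemen1994
open Literature.AlgebraicTopology.SingularHomology
open Literature.Geometry.Kaehler
open Summit.HodgeConjecture.HodgeConjecture.WeilTypeLadder
open Summit.HodgeConjecture.HodgeConjecture.Ring2.Hypotheses

namespace Summit.HodgeConjecture.HodgeConjecture.Ring2.AbelianAll

/-! ### §1 `det H` under the conjugate structure `φ ↦ -φ` -/

/-- `(-1)² · d = d`: the rescaling datum of complex conjugation `√-d ↦ -√-d` on `K_d` for the tree's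
`weilFieldHom`. [folklore] -/
theorem weilField_conj_datum (d : ℕ) : (-1 : ℚ) ^ 2 * (d : ℚ) = (d : ℚ) := by
  rw [neg_one_sq, one_mul]

/-- **The Gram determinant under `a ↦ -a` (EVEN size `2n`)**: `Ψ(-a, b) = -a + b√-d = -σ(Ψ(a, b))` with `σ` the
conjugation `√-d ↦ -√-d` of `K_d` (`weilFieldHom d d (-1)`), hence `det Ψ(-a, b) = (-1)^{2n} σ(det Ψ(a, b)) =
σ(det Ψ(a, b))`. [cite: vanGeemen1994HodgeAV, Lemma 5.2 (2)–(3)] -/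
theorem det_weilGramMatrix_neg_left (d : ℕ) {n : ℕ} (a b : Matrix (Fin (2 * n)) (Fin (2 * n)) ℚ) :
    (weilGramMatrix d (-a) b).det =
      weilFieldHom d d (-1) (weilField_conj_datum d) (weilGramMatrix d a b).det := by
  have e : weilGramMatrix d (-a) b = weilGramMatrix d ((-1 : ℚ) • a) ((-1 : ℚ) • ((-1 : ℚ) • b)) := by
    congr 1 <;> simp
  rw [e, det_weilGramMatrix_smul, AlgHom.map_det, weilFieldHom_mapMatrix_weilGramMatrix, pow_mul, neg_one_sq,
    one_pow, map_one, one_mul]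

/-- `(-φ)^* v = -(φ^* v)` on `H¹`, applied form of `HodgeTheory.complexBetti_map_neg_one`.
[cite: LangeBirkenhake1992, §1.1 (p. 19)] -/
theorem complexBetti_map_neg_one_apply {A B : AbelianVariety ℂ} (f : A ⟶ B) (v : complexBetti B.X 1) :
    complexBetti.map (-f).hom.hom.hom 1 v = -(complexBetti.map f.hom.hom.hom 1 v) := by
  rw [complexBetti_map_neg_one]; rfl

/-- **`det H` OF THE CONJUGATE STRUCTURE.** If `(A, φ, h)` has a non-degenerate discriminant witness of class
`δ ∈ ℚˣ/Nm(K_dˣ)` (`K`-rank `2n`), then so has `(A, -φ, h)`: in the same rational `K`-frame `x` (its `(-φ)^*`-translates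
are the negatives of the `φ^*`-translates, still independent), with the same reference top class `ω`,
`Q_h(xᵢ, (-φ)^*xⱼ) = -aᵢⱼ ω`, `Q_h(xᵢ, xⱼ) = bᵢⱼ ω`, and `det Ψ(-a, b) = σ(det Ψ(a, b)) = σ(q) = q`
(`det_weilGramMatrix_neg_left`). Van Geemen 5.2 (2)–(3) for the conjugate embedding `K ↪ End⁰(A)`; "`δ̄ = δ`".
[cite: vanGeemen1994HodgeAV, Lemma 5.2 (2)–(3)] -/
theorem hasWeilDiscriminantNondeg_neg {A : AbelianVariety ℂ} {φ : A ⟶ A} {n d : ℕ} {h : complexBetti A.X 2}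
    {δ : weilNormResidueGroup d} (hW : HasWeilDiscriminantNondeg A φ n d h δ) :
    HasWeilDiscriminantNondeg A (-φ) n d h δ := by
  obtain ⟨x, ω, a, b, q, hx, hind, hω, hω0, hQ, hdet, hq⟩ := hW
  refine ⟨x, ω, -a, b, q, hx, ?_, hω, hω0, fun i j => ⟨?_, (hQ i j).2⟩, ?_, hq⟩
  · -- the `(-φ)^*`-translates are `(-1) •` the `φ^*`-translates
    have e : Sum.elim x (fun i => complexBetti.map (-φ).hom.hom.hom 1 (x i)) =
        Sum.elim x (fun i => (-1 : ℂ) • complexBetti.map φ.hom.hom.hom 1 (x i)) := by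
      congr 1
      funext i
      rw [complexBetti_map_neg_one_apply, neg_one_smul]
    rw [e, linearIndependent_sum_elim_smul_iff _ _ (by norm_num : (-1 : ℂ) ≠ 0)]
    exact hind
  · -- `Q_h(xᵢ, (-φ)^* xⱼ) = -aᵢⱼ • ω`
    rw [complexBetti_map_neg_one_apply, map_neg, (hQ i j).1, Matrix.neg_apply, Rat.cast_neg, neg_smul]
  · -- `det Ψ(-a, b) = σ(q) = q`
    rw [det_weilGramMatrix_neg_left, hdet, weilFieldHom_algebraMap]

/-- **`(A, -φ, h)` has non-degenerate class `δ` iff `(A, φ, h)` has**: the conjugate variety `X̄` lies in the same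
discriminant component `(n, d, δ)` as `X`. [cite: vanGeemen1994HodgeAV, Lemma 5.2 (2)–(3)] -/
theorem hasWeilDiscriminantNondeg_neg_iff {A : AbelianVariety ℂ} {φ : A ⟶ A} {n d : ℕ} {h : complexBetti A.X 2}
    {δ : weilNormResidueGroup d} :
    HasWeilDiscriminantNondeg A (-φ) n d h δ ↔ HasWeilDiscriminantNondeg A φ n d h δ :=
  ⟨fun hW => by simpa only [neg_neg] using hasWeilDiscriminantNondeg_neg hW, hasWeilDiscriminantNondeg_neg⟩

/-! ### §2 The conjugate-twisted product `(A × B, φ × (-ψ))` -/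

/-- **`det H` OF THE TWISTED PRODUCT is `δ_A · δ_B`.** For `(A, φ, h_A)` of non-degenerate class `δ_A` (`dim A = 2n_A`,
`K`-rank `2n_A`) and `(B, ψ, h_B)` of class `δ_B` (`dim B = 2n_B`), rational classes of non-zero top powers, the
twisted product `(A × B, φ × (-ψ), pr_A^*h_A + pr_B^*h_B)` carries a non-degenerate witness of class `δ_A · δ_B`, and the
top power of `pr_A^*h_A + pr_B^*h_B` is non-zero — `(B, -ψ, h_B)` has class `δ_B` (§1) and `det H` is multiplicative
(`hasWeilDiscriminantNondeg_prod`). [cite: vanGeemen1994HodgeAV, Lemma 5.2 (2)–(3)]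
[cite: Markman2025SurveySecant, §11.5 Step 2] -/
theorem hasWeilDiscriminantNondeg_twistedProd {A B : AbelianVariety ℂ} {φ : A ⟶ A} {ψ : B ⟶ B} {nA nB d : ℕ}
    (hnA : 0 < nA) (hnB : 0 < nB) (hA : A.dim = 2 * nA) (hB : B.dim = 2 * nB)
    {hA2 : complexBetti A.X 2} {hB2 : complexBetti B.X 2} (hrA : IsRationalClass hA2)
    (hrB : IsRationalClass hB2) (htA : lefschetzPow hA2 (2 * nA - 1) 2 hA2 ≠ 0)
    (htB : lefschetzPow hB2 (2 * nB - 1) 2 hB2 ≠ 0) {δA δB : weilNormResidueGroup d}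
    (hWA : HasWeilDiscriminantNondeg A φ nA d hA2 δA) (hWB : HasWeilDiscriminantNondeg B ψ nB d hB2 δB) :
    HasWeilDiscriminantNondeg (A.prod B)
        (AbelianVariety.prodLift (AbelianVariety.fst A B ≫ φ) (AbelianVariety.snd A B ≫ (-ψ))) (nA + nB) d
        (complexBetti.map (AbelianVariety.fst A B).hom.hom.hom 2 hA2 +
          complexBetti.map (AbelianVariety.snd A B).hom.hom.hom 2 hB2) (δA * δB) ∧
      lefschetzPow (complexBetti.map (AbelianVariety.fst A B).hom.hom.hom 2 hA2 +
          complexBetti.map (AbelianVariety.snd A B).hom.hom.hom 2 hB2) (2 * (nA + nB) - 1) 2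
        (complexBetti.map (AbelianVariety.fst A B).hom.hom.hom 2 hA2 +
          complexBetti.map (AbelianVariety.snd A B).hom.hom.hom 2 hB2) ≠ 0 :=
  hasWeilDiscriminantNondeg_prod hnA hnB hA hB hrA hrB htA htB hWA (hasWeilDiscriminantNondeg_neg hWB)

/-- **The twisted product is of Weil type `(n_A + n_B, d)`** when `(A, φ)`, `(B, ψ)` are of Weil types `(n_A, d)`,
`(n_B, d)`: `(B, -ψ)` is of Weil type `(n_B, d)` (`HodgeTheory.IsWeilType.neg`) and multiplicities add
(`HodgeTheory.IsWeilType.prod`). [cite: vanGeemen1994HodgeAV, 4.9] -/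
theorem isWeilType_twistedProd {A B : AbelianVariety ℂ} {φ : A ⟶ A} {ψ : B ⟶ B} {nA nB d : ℕ}
    (hA : IsWeilType A φ nA d) (hB : IsWeilType B ψ nB d) :
    IsWeilType (A.prod B)
      (AbelianVariety.prodLift (AbelianVariety.fst A B ≫ φ) (AbelianVariety.snd A B ≫ (-ψ))) (nA + nB) d :=
  hA.prod hB.neg

/-! ### §3 Two members of ONE component `(n, d, δ)`: the twisted product is SPLIT -/

/-- `[(-1)^{n+n}] = 1` in `ℚˣ/Nm(K_dˣ)`: the split class of `K`-rank `4n` is trivial.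
[cite: vanGeemen1994HodgeAV, (5.4.1)] -/
theorem splitDiscriminantClass_add_self (n d : ℕ) : splitDiscriminantClass (n + n) d = 1 := by
  show (QuotientGroup.mk ((-1 : ℚˣ) ^ (n + n)) : weilNormResidueGroup d) = 1
  rw [pow_add, QuotientGroup.mk_mul]
  exact weilNormResidueGroup_mul_self _

/-- **SAME CLASS ⟹ SPLIT CLASS.** For `(A, φ, h_A)` and `(B, ψ, h_B)` both of `K`-rank `2n` (`dim A = dim B = 2n`) with
non-degenerate witnesses of ONE AND THE SAME class `δ`, the twisted product `(A × B, φ × (-ψ), pr_A^*h_A + pr_B^*h_B)` has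
a non-degenerate witness of the SPLIT class `[(-1)^{n+n}] = 1` (`δ · δ = 1`: `q² = Nm(q)`). "`disc(X × X̄') = δ δ̄' =
δ² ∈ Nm(K^×)`". [cite: vanGeemen1994HodgeAV, 4.14, Lemma 5.2 (3) and (5.4.1)] -/
theorem hasWeilDiscriminantNondeg_twistedProd_split {A B : AbelianVariety ℂ} {φ : A ⟶ A} {ψ : B ⟶ B} {n d : ℕ}
    (hn : 0 < n) (hA : A.dim = 2 * n) (hB : B.dim = 2 * n)
    {hA2 : complexBetti A.X 2} {hB2 : complexBetti B.X 2} (hrA : IsRationalClass hA2)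
    (hrB : IsRationalClass hB2) (htA : lefschetzPow hA2 (2 * n - 1) 2 hA2 ≠ 0)
    (htB : lefschetzPow hB2 (2 * n - 1) 2 hB2 ≠ 0) {δ : weilNormResidueGroup d}
    (hWA : HasWeilDiscriminantNondeg A φ n d hA2 δ) (hWB : HasWeilDiscriminantNondeg B ψ n d hB2 δ) :
    HasWeilDiscriminantNondeg (A.prod B)
        (AbelianVariety.prodLift (AbelianVariety.fst A B ≫ φ) (AbelianVariety.snd A B ≫ (-ψ))) (n + n) d
        (complexBetti.map (AbelianVariety.fst A B).hom.hom.hom 2 hA2 +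
          complexBetti.map (AbelianVariety.snd A B).hom.hom.hom 2 hB2) (splitDiscriminantClass (n + n) d) := by
  have hcl : splitDiscriminantClass (n + n) d = δ * δ := by
    rw [splitDiscriminantClass_add_self, weilNormResidueGroup_mul_self]
  rw [hcl]
  exact (hasWeilDiscriminantNondeg_twistedProd hn hn hA hB hrA hrB htA htB hWA hWB).1

/-- **TWO MEMBERS OF ONE COMPONENT HAVE A TWISTED PRODUCT OF SPLIT WEIL TYPE** (Landherr on the carriers). Let `(A, φ)`
and `(B, ψ)` be of Weil type `(n, d)` with projective embeddings `e_A`, `e_B` and non-zero rational ambient classes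
`a_A`, `a_B` whose `K`-symmetrised hyperplane classes `d·e_A^*a_A + φ^*e_A^*a_A`, `d·e_B^*a_B + ψ^*e_B^*a_B` have
non-degenerate discriminant classes EQUAL to one `δ ∈ ℚˣ/Nm(K_dˣ)` (two members of the component `(n, d, δ)`). Then the
conjugate-twisted product `(A × B, φ × (-ψ))` is of SPLIT Weil type `(n + n, d)`: the `K`-symmetrised class of
`(B, -ψ, e_B, a_B)` is that of `(B, ψ, e_B, a_B)` (`(-ψ)^* = ψ^*` on `H²`, `HodgeTheory.map_neg_two`) and has class `δ`
for `-ψ` (§1), so ab-weil-2's `isSplitWeilType_prod_of_class_eq_of_isWeilType` applies to `(A, φ)`, `(B, -ψ)`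
(Segre class of class `δ² = [(-1)^{2n}]`, `VanGeemen1994.IsWeilType.isSplitWeilType_of_hasWeilDiscriminantNondeg_split`).
The print sentence "the twisted products `X_s × X̄_t` are of split type whatever the fibre discriminant", for two
members of one discriminant component. [cite: vanGeemen1994HodgeAV, Lemma 5.2 (2)–(4), 5.4 and (5.4.1)]
[cite: Landherr1936HermitianForms] -/
theorem isSplitWeilType_twistedProd_of_class_eq {A B : AbelianVariety ℂ} {φ : A ⟶ A} {ψ : B ⟶ B} {n d : ℕ}
    (hWA' : IsWeilType A φ n d) (hWB' : IsWeilType B ψ n d)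
    (eA : ProjectiveEmbedding A.X) {aA : complexBetti (projectiveSpace eA.n ℂ) 2} (haA : IsRationalClass aA)
    (haA0 : aA ≠ 0)
    (eB : ProjectiveEmbedding B.X) {aB : complexBetti (projectiveSpace eB.n ℂ) 2} (haB : IsRationalClass aB)
    (haB0 : aB ≠ 0) {δ : weilNormResidueGroup d}
    (hWA : HasWeilDiscriminantNondeg A φ n d
      ((d : ℂ) • complexBetti.map eA.ι 2 aA + complexBetti.map φ.hom.hom.hom 2 (complexBetti.map eA.ι 2 aA)) δ)
    (hWB : HasWeilDiscriminantNondeg B ψ n d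
      ((d : ℂ) • complexBetti.map eB.ι 2 aB + complexBetti.map ψ.hom.hom.hom 2 (complexBetti.map eB.ι 2 aB)) δ) :
    IsSplitWeilType (A.prod B)
      (AbelianVariety.prodLift (AbelianVariety.fst A B ≫ φ) (AbelianVariety.snd A B ≫ (-ψ))) (n + n) d := by
  have hWBneg : HasWeilDiscriminantNondeg B (-ψ) n d
      ((d : ℂ) • complexBetti.map eB.ι 2 aB + complexBetti.map (-ψ).hom.hom.hom 2 (complexBetti.map eB.ι 2 aB)) δ := by
    rw [map_neg_two]
    exact hasWeilDiscriminantNondeg_neg hWB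
  exact isSplitWeilType_prod_of_class_eq_of_isWeilType hWA' hWB'.neg eA haA haA0 eB haB haB0 hWA hWBneg

/-! ### §4 The edge to the cell's ladder: the split cell `(2n, d, [1])` gives the Weil classes of `X × X̄'` -/

/-- **Granted the split class target `WeilClassesComponent (n + n) d [(-1)^{n+n}]` ALONE** (binder `h`), every rational Weil
class of Hodge type `(n + n, n + n)` of the conjugate-twisted product `(A × B, φ × (-ψ))` of two members of a component
`(n, d, δ)` (hypotheses of `isSplitWeilType_twistedProd_of_class_eq`) is algebraic
(`Ring2.Hypotheses.weilClasses_algebraic_of_isSplitWeilType_of_split_component`). The member-wise typed edge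
«split cell `(2n, d, [1])` ⟹ Weil classes of `X_s × X̄_t`»; node level nothing new (Schoen/Markman descent).
[cite: vanGeemen1994HodgeAV, Lemma 5.2 (2)–(4) and (5.4.1)] [cite: Markman2025SurveySecant, §11.5] -/
theorem weilClasses_algebraic_twistedProd_of_split_component {A B : AbelianVariety ℂ} {φ : A ⟶ A} {ψ : B ⟶ B}
    {n d : ℕ} (h : WeilClassesComponent (n + n) d (splitDiscriminantClass (n + n) d))
    (hWA' : IsWeilType A φ n d) (hWB' : IsWeilType B ψ n d)
    (eA : ProjectiveEmbedding A.X) {aA : complexBetti (projectiveSpace eA.n ℂ) 2} (haA : IsRationalClass aA)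
    (haA0 : aA ≠ 0)
    (eB : ProjectiveEmbedding B.X) {aB : complexBetti (projectiveSpace eB.n ℂ) 2} (haB : IsRationalClass aB)
    (haB0 : aB ≠ 0) {δ : weilNormResidueGroup d}
    (hWA : HasWeilDiscriminantNondeg A φ n d
      ((d : ℂ) • complexBetti.map eA.ι 2 aA + complexBetti.map φ.hom.hom.hom 2 (complexBetti.map eA.ι 2 aA)) δ)
    (hWB : HasWeilDiscriminantNondeg B ψ n d
      ((d : ℂ) • complexBetti.map eB.ι 2 aB + complexBetti.map ψ.hom.hom.hom 2 (complexBetti.map eB.ι 2 aB)) δ)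
    {c : complexBetti (A.prod B).X (2 * (n + n))} (hcQ : IsRationalClass c)
    (hcH : IsOfHodgeType (2 * (n + n)) (A.prod B).X (2 * (n + n)) (n + n) (n + n) c)
    (hw : c ∈ weilClassesOf (A.prod B)
      (AbelianVariety.prodLift (AbelianVariety.fst A B ≫ φ) (AbelianVariety.snd A B ≫ (-ψ))) (n + n) d) :
    c ∈ algebraicClasses (A.prod B).X (n + n) :=
  weilClasses_algebraic_of_isSplitWeilType_of_split_component h
    (isSplitWeilType_twistedProd_of_class_eq hWA' hWB' eA haA haA0 eB haB haB0 hWA hWB) hcQ hcH hw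

end Summit.HodgeConjecture.HodgeConjecture.Ring2.AbelianAll

end
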